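import Summits.BirchSwinnertonDyer.BirchSwinnertonDyer.Theorems.AdditiveKolyvaginRoadLevelKolyvaginSystemsAdditiveGammaLocus
import Summits.BirchSwinnertonDyer.BirchSwinnertonDyer.Theorems.AdditiveKolyvaginRoadLevelKolyvaginSystemsAdditiveStubTamagawaOffP
import Summits.BirchSwinnertonDyer.BirchSwinnertonDyer.Theorems.AdditiveKolyvaginRoadLevelSystemsOfIgnition
import Summits.BirchSwinnertonDyer.BirchSwinnertonDyer.Theorems.AdditiveKolyvaginRoadLevelKolyvaginSystemsAdditiveStubLenderSeed
import Summits.BirchSwinnertonDyer.BirchSwinnertonDyer.Theorems.AdditiveKolyvaginRoadLevelKolyvaginSystemsAdditiveStubKummerLineAtP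
import Summits.BirchSwinnertonDyer.BirchSwinnertonDyer.Theorems.AdditiveKolyvaginRoadSignAgreementOfTorsionCongr
import Summits.BirchSwinnertonDyer.BirchSwinnertonDyer.Theorems.AdditiveKolyvaginRoadLevelKolyvaginSystemsAdditiveStubLenderCoreConnected
import Summits.BirchSwinnertonDyer.BirchSwinnertonDyer.Theorems.AdditiveKolyvaginRoadLevelKolyvaginSystemsAdditiveStubLenderDatumOfZhangFact
import Summits.BirchSwinnertonDyer.BirchSwinnertonDyer.Theorems.AdditiveKolyvaginRoadLevelSystemsSelmerBottom
import Literature.NumberTheory.EllipticCurves.KrizLi2019.HeegnerLogCongruence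
import Literature.NumberTheory.EllipticCurves.WZhang2014.LevelRaisedBipartiteSystem
import Literature.NumberTheory.QuadraticFields.KroneckerSplitting
import Literature.NumberTheory.EllipticCurves.PAdicLFunction
import Literature.NumberTheory.EllipticCurves.RootNumber
import Literature.NumberTheory.EllipticCurves.BSDSelmer
import Literature.NumberTheory.EllipticCurves.BSDSha
import HarnessLib

/-!
# Route `AdditiveKolyvaginRoad`, crux KS′ `LevelKolyvaginSystemsAdditive` (item stmt-BirchSwinnertonDyer-21396):
# KS′ ON THE (γ)-AVATAR LOCUS, CONDITIONAL ON REFEREED NAMED FACTS ONLY — the on-locus branch of line `epsilon_matched_retyping`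
# (skeleton v8) as a standalone theorem (cell `pub/bsd-wall`, lead `cruxlead-stmt-BirchSwinnertonDyer-21396`;
# `--supports stmt-BirchSwinnertonDyer-21396`, helper)

WHAT. For every ♯ additive frame `(E, p, K, Dt, β, ι)` of the crux (binders VERBATIM) that carries a (γ)-AVATAR — a `p`-good ordinary
non-anomalous elliptic curve `E₀/ℚ` with `E₀[p] ≅ E[p]` over `ℚ`, ♠(1) and `p ∤ ∏ c_ℓ(E₀)`, the same primes of bad reduction off `p`,
`N₀ p² = N`, the same multiplicative primes and the same global root number, Heegner data `(Dt₀, β₀)` with `p ∤ c₀`, and the LOG CERTIFICATE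
«a Heegner point of `E₀` over `heegnerPointComplex Dt₀ H₀`, `β(H₀) = β₀`, is not `p`-divisible in `E₀(ℚ_p)` along `ιp`» — and every complex
conjugation `c ≠ 1`, the carrier `LevelKolyvaginSystemP E K p Dt β ι c` of W. Zhang's level Kolyvagin systems is inhabited, GRANTED ONLY the
displayed refereed named facts: Dokchitser–Dokchitser `p`-parity, the Cassels–Tate pairing over `ℚ`, Poitou–Tate duality for Selmer structures
over `ℚ`, Kriz–Li 2019 Thm. 1.16, the route's bundles `PublishedInputsAdditiveKoly` ∕ `PublishedDualityInputsAdditiveKoly`, and W. Zhang 2014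
§§3–4/§8.1 (`WZhang2014.exists_levelRaisedBipartiteSystem`).  Every other input is a tree theorem: θ (p602788), (Tam) (p606147), (θK)ₚ (p610049),
sign agreement (p609488), the lender's seed (p608045), its core-connectivity (p611000), its datum dictionary (stub S5a′), the rigidity
constructor (p589600), the Kriz–Li bottom transfer and γ-assembly (p604313/p605382/p605510/p605896).

HONEST FRAMING: one theorem, 0 sorry, CONDITIONAL on the seven named facts (hypotheses; the gate records conditional-result).  It does NOT close
KS′ (the crux quantifies over ALL ♯ frames; off the (γ)-avatar locus nothing is claimed) and BSD is NOT proved by any of this.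
-/

set_option linter.dupNamespace false
set_option autoImplicit false

noncomputable section

open scoped Classical

open WeierstrassCurve NumberField IsDedekindDomain Field
  Literature.NumberTheory.EllipticCurves Literature.NumberTheory.EllipticCurves.ModularForms
  Literature.NumberTheory.EllipticCurves.Rank1Residual Literature.NumberTheory.GaloisRepresentations
  Literature.NumberTheory.GaloisCohomology
  Summit.BirchSwinnertonDyer.BirchSwinnertonDyer.Theses.AdditiveKolyvaginRoad
  Summit.BirchSwinnertonDyer.Rank1Residual

namespace Summit.BirchSwinnertonDyer.BirchSwinnertonDyer.Theorems.AdditiveKoly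

/-- **KS′ ON THE (γ)-AVATAR LOCUS, modulo refereed named facts** (see the module docstring for the list).  The (γ)-avatar locus is the
inlined ∃-clause; the conclusion is the crux's own `Nonempty (LevelKolyvaginSystemP W K p Dt β ι c)`.
[cite: WZhang2014, Thm. 2.1, §3.9 (3.30), Thm. 4.3, Thm. 5.2, §8.1] [cite: KrizLi2019, Thm. 1.16] [cite: DokchitserDokchitserAnnals2010, Thm. 1.4]
[cite: Howard2006Bipartite, Prop. 2.4.11] [cite: BertoliniDarmon2005, Thm. 4.1, Thm. 4.2] [cite: GrossLMS1991, §4 (4.4), Prop. 5.4] -/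
theorem levelKolyvaginSystemsAdditive_onGammaAvatarLocus
    (hDD : ∀ (V : WeierstrassCurve ℚ) [V.IsElliptic] (q : ℕ) [Fact q.Prime], p_parity V q)
    (hCT : WeierstrassCurve.exists_casselsTate_pairing (K := ℚ)) (hPT : poitouTate_selmerStructure_duality ℚ)
    (hKL : KrizLi2019.thm116_padicLogHeegner_congruence) (hPUB : PublishedInputsAdditiveKoly) (hDual : PublishedDualityInputsAdditiveKoly)
    (hZ : WZhang2014.exists_levelRaisedBipartiteSystem)
    (W : WeierstrassCurve ℚ) [W.IsElliptic] [W.IsGloballyMinimal] [NeZero (W.conductorNorm ℤ)]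
    (p : ℕ) [Fact p.Prime] (K : Type) [Field K] [NumberField K]
    (Dt : ModularParametrizationData W (W.conductorNorm ℤ)) (β : ℤ) (ι : K →+* ℂ)
    (hp : 5 ≤ p) (hadd : Addv W p) (hs : W.HasSurjectiveModNGaloisRep p)
    (hsp : ∀ (ℓ : ℕ) [Fact ℓ.Prime], W.HasMultiplicativeReductionAtPrime ℓ → ¬ p ∣ padicValInt ℓ W.minimalDiscriminantInt)
    (htwo : ∃ (ℓ₁ ℓ₂ : ℕ) (_ : Fact ℓ₁.Prime) (_ : Fact ℓ₂.Prime), ℓ₁ ≠ ℓ₂ ∧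
      W.HasMultiplicativeReductionAtPrime ℓ₁ ∧ W.HasMultiplicativeReductionAtPrime ℓ₂)
    (htam : ¬ p ∣ W.tamagawaProduct) (hr : W.analyticRank = 1) (hK : IsImaginaryQuadratic K) (hodd : Odd (NumberField.discr K))
    (hlt : NumberField.discr K < -4) (hH : SatisfiesHeegnerHypothesis (W.conductorNorm ℤ) K)
    (hL : (W.quadraticTwist (NumberField.discr K : ℚ)).entireLFunction 1 ≠ 0)
    (hβ : (4 * (W.conductorNorm ℤ : ℤ)) ∣ β ^ 2 - NumberField.discr K) (hc : ¬ (p : ℤ) ∣ Dt.c)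
    (hav : ∃ (W₀ : WeierstrassCurve ℚ) (_ : W₀.IsElliptic) (_ : W₀.IsGloballyMinimal) (_ : NeZero (W₀.conductorNorm ℤ))
      (Dt₀ : ModularParametrizationData W₀ (W₀.conductorNorm ℤ)) (β₀ : ℤ)
      (e : geomTorsion W (p : ℤ) ≃+ geomTorsion W₀ (p : ℤ)),
      (∀ (σ : absoluteGaloisGroup ℚ) (P : geomTorsion W (p : ℤ)), e (σ • P) = σ • e P) ∧
      IsOrdinaryAt W₀ p ∧ ¬ (p : ℤ) ∣ W₀.frobeniusTrace p - 1 ∧ W₀.HasSurjectiveModNGaloisRep p ∧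
      (∀ (ℓ : ℕ) [Fact ℓ.Prime], W₀.HasMultiplicativeReductionAtPrime ℓ →
        ¬ p ∣ padicValInt ℓ W₀.minimalDiscriminantInt) ∧
      ¬ p ∣ W₀.tamagawaProduct ∧
      (∀ q : ℕ, q.Prime → (q ∣ p * W.conductorNorm ℤ ↔ q ∣ p * W₀.conductorNorm ℤ)) ∧
      W₀.conductorNorm ℤ * p ^ 2 = W.conductorNorm ℤ ∧
      (∀ (ℓ : ℕ) [Fact ℓ.Prime], W.HasMultiplicativeReductionAtPrime ℓ ↔ W₀.HasMultiplicativeReductionAtPrime ℓ) ∧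
      W₀.rootNumber = W.rootNumber ∧ SatisfiesHeegnerHypothesis (W₀.conductorNorm ℤ) K ∧
      (4 * (W₀.conductorNorm ℤ : ℤ)) ∣ β₀ ^ 2 - NumberField.discr K ∧ ¬ (p : ℤ) ∣ Dt₀.c ∧
      ∃ (ιp : K →+* ℚ_[p]) (H₀ : HeegnerDatum (W₀.conductorNorm ℤ) (NumberField.discr K))
        (y₀ : (W₀.baseChange K).toAffine.Point),
        H₀.β = β₀ ∧ WeierstrassCurve.Affine.Point.map ι.toRatAlgHom y₀ = heegnerPointComplex Dt₀ H₀ ∧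
          ¬ ∃ Q : (W₀.baseChange ℚ_[p]).toAffine.Point, (p : ℤ) • Q = X11b.padicPointOf W₀ p ιp y₀) :
    ∀ (c : K ≃ₐ[ℚ] K), c ≠ 1 → ∀ [Module (ZMod p) (Vp W K p)], Nonempty (LevelKolyvaginSystemP W K p Dt β ι c) := by
  intro c hc1 _
  obtain ⟨W₀, _, _, _, Dt₀, β₀, e, he, hord, hna, hs₀, hsp₀, htam₀, hrad, hN₀, htype, hroot, hH₀, hβ₀, hc₀,
    ιp, hcert⟩ := hav
  -- locus clause (i) SIGN AGREEMENT is automatic (w3 g5, p609488: Tate curve + torsion congruence at a multiplicative ℓ ≠ p)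
  have hsign : ∀ (ℓ : ℕ) [Fact ℓ.Prime], W₀.HasMultiplicativeReductionAtPrime ℓ → W.LFunction ℓ = W₀.LFunction ℓ :=
    sign_agreement_of_torsionCongr W W₀ p hp hadd hsp₀ htype e he
  -- `p` splits in `K`: `p ∣ N_E` (additive reduction) and `K` is Heegner for `N_E`
  have hsplit : ((Ideal.span {(p : ℤ)}).primesOver (𝓞 K)).ncard = 2 :=
    hH p (Fact.out : p.Prime) ((W.dvd_conductorNorm_iff_not_hasGoodReductionAtPrime p).mpr hadd.1)
  -- Hypothesis ♠(2) for the avatar: the frame's two multiplicative primes are multiplicative for `E₀`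
  have htwo₀ : ∃ (ℓ₁ ℓ₂ : ℕ) (_ : Fact ℓ₁.Prime) (_ : Fact ℓ₂.Prime), ℓ₁ ≠ ℓ₂ ∧
      W₀.HasMultiplicativeReductionAtPrime ℓ₁ ∧ W₀.HasMultiplicativeReductionAtPrime ℓ₂ := by
    obtain ⟨ℓ₁, ℓ₂, i₁, i₂, hne, h₁, h₂⟩ := htwo
    exact ⟨ℓ₁, ℓ₂, i₁, i₂, hne, (htype ℓ₁).mp h₁, (htype ℓ₂).mp h₂⟩
  -- the `ZMod p`-structure on `H¹(K, E₀[p])` (killed by `p ^ 1`)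
  letI : Module (ZMod p) (Vp W₀ K p) := AddCommGroup.zmodModule (fun x ↦ by
    simpa only [pow_one] using nsmul_galH1Torsion_natCast_eq_zero (W₀.baseChange K) (p ^ 1) x)
  -- (Tam) at the bad places prime to `p` (landed stub S3, w3 p606147), (θK)ₚ above `p` (landed stub S4, w2 p610049)
  have hTam : ∀ v : HeightOneSpectrum (𝓞 K), (p : 𝓞 K) ∉ v.asIdeal →
      ¬ ((W.baseChange K).HasGoodReductionAt v ∧ (W₀.baseChange K).HasGoodReductionAt v) →
      ¬ p ∣ ((W.baseChange K).baseChange (v.adicCompletion K)).localTamagawaNumber (v.adicCompletionIntegers K) ∧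
      ¬ p ∣ ((W₀.baseChange K).baseChange (v.adicCompletion K)).localTamagawaNumber (v.adicCompletionIntegers K) :=
    fun v hvp hv ↦ stub_tamagawaOffP W W₀ p K htam htam₀ hK hH hrad v hvp hv
  have hKumP : ∀ (θ : geomTorsion (W₀.baseChange K) ((p ^ 1 : ℕ) : ℤ) ≃+ geomTorsion (W.baseChange K) ((p ^ 1 : ℕ) : ℤ))
      (hθ : ∀ (g : absoluteGaloisGroup K) (P : geomTorsion (W₀.baseChange K) ((p ^ 1 : ℕ) : ℤ)), θ (g • P) = g • θ P),
      ∀ v : HeightOneSpectrum (𝓞 K), (p : 𝓞 K) ∈ v.asIdeal →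
      ∀ y : Vp W₀ K p, h1Equiv θ hθ y ∈ selmerLocalKer (W.baseChange K) (v.adicCompletion K) ((p ^ 1 : ℕ) : ℤ) ↔
        y ∈ selmerLocalKer (W₀.baseChange K) (v.adicCompletion K) ((p ^ 1 : ℕ) : ℤ) :=
    fun θ hθ v hvp y ↦ stub_kummerLineAtP W W₀ p K (hDD W p) (hDD W₀ p) hCT hPT hp hs htam htam₀ hrad hord.1 hna hroot hK
      hsplit e he θ hθ v hvp y
  -- the certificate, in the weaker `β`-free form consumed by the (γ)-transfer
  have hcert' : ∃ (H₀ : HeegnerDatum (W₀.conductorNorm ℤ) (NumberField.discr K)) (y₀ : (W₀.baseChange K).toAffine.Point),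
      WeierstrassCurve.Affine.Point.map ι.toRatAlgHom y₀ = heegnerPointComplex Dt₀ H₀ ∧
        ¬ ∃ Q : (W₀.baseChange ℚ_[p]).toAffine.Point, (p : ℤ) • Q = X11b.padicPointOf W₀ p ιp y₀ := by
    obtain ⟨H₀, y₀, -, h₁, h₂⟩ := hcert
    exact ⟨H₀, y₀, h₁, h₂⟩
  -- THE LENDER's LEVEL SYSTEM from its bipartite datum (S5a), its seed (S5c) and core-connectivity (S5b), by rigidity
  have hseed₀ : ∀ d₀ : KolyvaginHeegnerData Dt₀ β₀ ι 1, d₀.kolyvaginClass (Fact.out : p.Prime) 1 ≠ 0 :=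
    stub_lenderSeed W₀ p K Dt₀ β₀ ι hp hs₀ hK hlt hH₀ ιp hcert
  -- `p ∤ d_K`: `p` is odd and SPLIT in the quadratic field `K` (decomposition law)
  have hpd : ¬ ((p : ℤ) ∣ NumberField.discr K) := by
    have hp2 : p ≠ 2 := by omega
    have hleg := (Literature.NumberTheory.QuadraticFields.Quadratic.ncard_primesOver_eq_two_iff_legendreSym hK.1 hp2).mp hsplit
    intro hdvd
    have h0 : legendreSym p (NumberField.discr K) = 0 :=
      (legendreSym.eq_zero_iff p _).mpr ((ZMod.intCast_zmod_eq_zero_iff_dvd _ p).mpr hdvd)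
    rw [h0] at hleg
    exact zero_ne_one hleg
  obtain ⟨ε₀, κ₀, lam, hreal, hsgn, hoff, hinf, htor, htr, hrel, hA, hB⟩ :=
    stub_lenderDatumOfZhangFact W₀ p K Dt₀ β₀ ι hp hord hs₀ hsp₀ htwo₀ hK hodd hlt hsplit hH₀ hβ₀ c hc1 hpd hZ
  have hconn := stub_lenderCoreConnected W W₀ p K Dt Dt₀ β β₀ ι c hPUB hDual hKL hp hadd hs hsp htwo htam hr hK hodd hlt hH
    hL hβ hc e he hord.1 hna hs₀ hsp₀ htam₀ hrad hN₀ htype hroot hH₀ hβ₀ hc₀ hsign hc1 hKumP hseed₀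
  have hseed : (Even (∅ : Finset (AdmQ W₀ K p)).card ∧ κ₀ ∅ ∅ ≠ 0) ∨
      (Odd (∅ : Finset (AdmQ W₀ K p)).card ∧ lam ∅ ∅ ≠ 0) := by
    refine Or.inl ⟨by simp, ?_⟩
    obtain ⟨d₁, hd₁⟩ := hreal ∅
    rw [hd₁]
    exact hseed₀ d₁
  obtain ⟨S₀⟩ := nonempty_levelKolyvaginSystemP_of_bipartite_of_seed W₀ K p c Dt₀ β₀ ι ε₀ κ₀ lam hreal hsgn hoff hinf htor
    htr hrel hA hB (selmer_bottom_of_realisation W₀ p K Dt₀ β₀ ι hs₀ hK hH₀ hc1 κ₀ hreal) ∅ hseed hconn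
  -- the landed (γ)-locus assembly (θ = landed S2, Kraus–Oesterlé, Kriz–Li bottom transfer, socket v3)
  exact nonempty_levelKolyvaginSystemP_on_gammaLocus W W₀ K p c hKL Dt β ι hp hadd hs hK hlt hH hβ hc e he hord.1 hna hrad
    htype hsign Dt₀ β₀ hc₀ hH₀ ιp S₀ hTam hKumP hcert'

end Summit.BirchSwinnertonDyer.BirchSwinnertonDyer.Theorems.AdditiveKoly

end
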